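import Mathlib.LinearAlgebra.Finsupp.LinearCombination
import Mathlib.LinearAlgebra.Quotient.Basic
import Mathlib.LinearAlgebra.Span.Basic
import Mathlib.GroupTheory.OrderOfElement
import Mathlib.Algebra.Order.Monoid.Submonoid
import Mathlib.Algebra.Order.Pi
import Mathlib.Algebra.Group.Submonoid.Operations
import Mathlib.Algebra.BigOperators.Fin
import Mathlib.Data.Int.Order.Basic
import HarnessLib

/-!
# Crux `FrobeniusLadder.FRationalResolution` (stmt-ResolutionOfSingularities-15317), line `redirect`,
# stub `stub_diagonalizableQuotientResolution` — the projection of the unit-exponent chart monoid to its NON-UNIT coordinates is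
# again a monoid of FIXED-POINT SHAPE (second brick of the «sharpening» step for WILD non-fixed points, memo MEMO-15317-leafhand4-g1
# §remaining (1))

Generic group bookkeeping. The chart monoids of `…FixedPointLogRegularNhd` / `…WildLogRegularNhd` are `P(c) = ℤᴺ_{≥0} ⊓ ker(v ↦ Σ v_l c_l)`
for degrees `c : Fin N → A` of finite order. Split the coordinates `Fin N ≃ Fin n ⊕ Fin m` (downstream: `n` non-unit exponents `y_l ∈ 𝔔`,
`m` unit exponents `y_l ∉ 𝔔`), let `H = ℤ⟨c_{inr j}⟩ ≤ A` and `c♯ : Fin n → A ⧸ H`, `c♯ i = [c_{inl i}]`. Then the projection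
`v ↦ (v_{inl i})_i` maps `P(c)` ONTO `P(c♯) = ℤⁿ_{≥0} ⊓ ker(m ↦ Σ m_i c♯_i)` — a monoid of the same fixed-point shape (so
`…SimplicialNormalization.exists_normalized_chart_forall_isPrimSimplicial` ✓ p824855 applies to it). Surjectivity uses the finite
orders: a `ℤ`-combination of the `c_{inr j}` can be made a NON-NEGATIVE one by reducing the coefficients modulo the orders.

* `emod_addOrderOf_smul` — `(d % ord a) • a = d • a`;
* `mem_chartMonoid_iff'` — membership in `P(c)` (restated locally, `rfl`-level);
* **`exists_mem_chartMonoid_proj_iff`** — `(∃ v ∈ P(c), v ∘ e ∘ inl = m) ↔ m ∈ P(c♯)`.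

Honest label: bookkeeping brick (no stub closed). No definitions, no named facts, no sorry. [folklore; cite: Kato1994, (1.5)]
-/

-- single-problem summit: the doubled namespace component is forced
set_option linter.dupNamespace false

namespace Summit.ResolutionOfSingularities.ResolutionOfSingularities.Theorems.FRationalResolution.SharpProjection

universe w

variable {A : Type w} [AddCommGroup A]

/-- Reducing an integer coefficient modulo the (finite) order does not change the multiple. [folklore] -/
theorem emod_addOrderOf_smul (a : A) (d : ℤ) : (d % (addOrderOf a : ℤ)) • a = d • a := by
  have h : d % (addOrderOf a : ℤ) = d - (d / (addOrderOf a : ℤ)) * (addOrderOf a : ℤ) := by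
    rw [eq_sub_iff_add_eq, add_comm, mul_comm, Int.mul_ediv_add_emod]
  rw [h, sub_zsmul, mul_zsmul, natCast_zsmul, addOrderOf_nsmul_eq_zero, zsmul_zero, neg_zero, add_zero]

/-- Membership in the chart monoid `P(c) = ℤᴺ_{≥0} ⊓ ker(v ↦ Σ v_l c_l)`. [folklore] -/
theorem mem_chartMonoid_iff' {N : ℕ} (c : Fin N → A) (v : Fin N → ℤ) :
    v ∈ (AddSubmonoid.nonneg (Fin N → ℤ) ⊓
      AddMonoidHom.mker (Fintype.linearCombination ℤ c).toAddMonoidHom) ↔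
      0 ≤ v ∧ ∑ l, v l • c l = 0 := by
  rw [AddSubmonoid.mem_inf, AddSubmonoid.mem_nonneg, AddMonoidHom.mem_mker, LinearMap.toAddMonoidHom_coe,
    Fintype.linearCombination_apply]

/-- **The projection of `P(c)` to a set of coordinates is `P(c♯)`, `c♯ = c mod ℤ⟨the other degrees⟩`.** For a splitting
`e : Fin n ⊕ Fin m ≃ Fin N`, degrees `c : Fin N → A` of finite order, `H = ℤ⟨c (e (inr j))⟩` and `c♯ i = [c (e (inl i))] ∈ A ⧸ H`:
a vector `m : Fin n → ℤ` is the `inl`-part of some `v ∈ P(c)` iff `m ∈ P(c♯)`. [folklore; cite: Kato1994, (1.5)] -/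
theorem exists_mem_chartMonoid_proj_iff {N n m : ℕ} (e : Fin n ⊕ Fin m ≃ Fin N) (c : Fin N → A)
    (hc : ∀ l, IsOfFinAddOrder (c l)) (mv : Fin n → ℤ) :
    (∃ v ∈ (AddSubmonoid.nonneg (Fin N → ℤ) ⊓
        AddMonoidHom.mker (Fintype.linearCombination ℤ c).toAddMonoidHom), ∀ i, v (e (Sum.inl i)) = mv i) ↔
      mv ∈ (AddSubmonoid.nonneg (Fin n → ℤ) ⊓
        AddMonoidHom.mker (Fintype.linearCombination ℤ (fun i : Fin n =>
          (Submodule.span ℤ (Set.range fun j : Fin m => c (e (Sum.inr j)))).mkQ (c (e (Sum.inl i))))).toAddMonoidHom) := by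
  classical
  set H : Submodule ℤ A := Submodule.span ℤ (Set.range fun j : Fin m => c (e (Sum.inr j))) with hH
  -- the sum over `Fin N` splits along `e`
  have hsplit : ∀ v : Fin N → ℤ, ∑ l, v l • c l =
      (∑ i, v (e (Sum.inl i)) • c (e (Sum.inl i))) + ∑ j, v (e (Sum.inr j)) • c (e (Sum.inr j)) := by
    intro v
    rw [← Fintype.sum_equiv e (fun x => v (e x) • c (e x)) (fun l => v l • c l) (fun x => rfl),
      Fintype.sum_sum_type]
  rw [mem_chartMonoid_iff']
  constructor
  · rintro ⟨v, hv, hvm⟩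
    rw [mem_chartMonoid_iff'] at hv
    obtain ⟨hv0, hvsum⟩ := hv
    refine ⟨fun i => by rw [← hvm i]; exact hv0 _, ?_⟩
    -- `Σ m_i [c_i] = [Σ m_i c_i] = [− Σ_j v_j c_j] = 0`
    have h1 : ∑ i, mv i • H.mkQ (c (e (Sum.inl i))) = H.mkQ (∑ i, mv i • c (e (Sum.inl i))) := by
      rw [map_sum]
      simp only [map_zsmul]
    rw [h1, Submodule.mkQ_apply, Submodule.Quotient.mk_eq_zero]
    have h2 : ∑ i, mv i • c (e (Sum.inl i)) = -∑ j, v (e (Sum.inr j)) • c (e (Sum.inr j)) := by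
      rw [eq_neg_iff_add_eq_zero]
      simp only [← hvm]
      rw [← hsplit, hvsum]
    rw [h2]
    exact H.neg_mem (Submodule.sum_mem _ fun j _ => Submodule.smul_mem _ _ (Submodule.subset_span ⟨j, rfl⟩))
  · rintro ⟨hm0, hmsum⟩
    have h1 : ∑ i, mv i • H.mkQ (c (e (Sum.inl i))) = H.mkQ (∑ i, mv i • c (e (Sum.inl i))) := by
      rw [map_sum]
      simp only [map_zsmul]
    rw [h1, Submodule.mkQ_apply, Submodule.Quotient.mk_eq_zero] at hmsum
    -- a `ℤ`-combination of the unit degrees ...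
    obtain ⟨d, hd⟩ := (Submodule.mem_span_range_iff_exists_fun ℤ).mp (H.neg_mem hmsum)
    -- ... made non-negative modulo the orders
    let d' : Fin m → ℤ := fun j => d j % (addOrderOf (c (e (Sum.inr j))) : ℤ)
    have hd'0 : ∀ j, 0 ≤ d' j := fun j =>
      Int.emod_nonneg _ (by exact_mod_cast (hc _).addOrderOf_pos.ne')
    have hd' : ∑ j, d' j • c (e (Sum.inr j)) = -∑ i, mv i • c (e (Sum.inl i)) := by
      rw [← hd]
      exact Finset.sum_congr rfl fun j _ => emod_addOrderOf_smul _ _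
    -- the lift
    let v : Fin N → ℤ := fun l => Sum.elim mv d' (e.symm l)
    have hvl : ∀ i, v (e (Sum.inl i)) = mv i := fun i => by simp [v]
    have hvr : ∀ j, v (e (Sum.inr j)) = d' j := fun j => by simp [v]
    refine ⟨v, ?_, hvl⟩
    rw [mem_chartMonoid_iff']
    refine ⟨fun l => ?_, ?_⟩
    · show 0 ≤ Sum.elim mv d' (e.symm l)
      rcases e.symm l with i | j
      · exact hm0 i
      · exact hd'0 j
    · rw [hsplit]
      simp only [hvl, hvr]
      rw [hd', add_neg_cancel]

end Summit.ResolutionOfSingularities.ResolutionOfSingularities.Theorems.FRationalResolution.SharpProjection
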